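import Summits.ValiantsHypothesis.ValiantsHypothesis.Theorems.KPlusLogSqLawTropicalBToeplitzConjectureT
import Summits.ValiantsHypothesis.ValiantsHypothesis.Theorems.KPlusLogSqLawTropicalBToeplitzAffineWrap

/-!
# Route `KPlusLogSqLaw`, crux `TropicalB` — Toeplitz sector: `Φ_Toep(m) ≥ m` for every `m` (the m-phase rung is sharp)

HONEST FRAMING.  Helper toward the registered stubs `stub_tropThin` / `stub_tropFat` of
`Cruxes/TropicalB/Lines/birth.lean` (crux `Summit.ValiantsHypothesis.ValiantsHypothesis.Theses.KPlusLogSqLaw.TropicalB`,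
ledger item `stmt-ValiantsHypothesis-19771`, route `KPlusLogSqLaw`; cell `pub-symmetroid`, seat `val-sym-trop-p3`,
2026-08-26).  A KERNEL LOWER BOUND for the cell's Conjecture T count at EVERY size: the residue instance
`ψ(δ) = δ mod m`, `α(δ) = −(δ mod m)²` has ALL `m` ROTATIONS `b ↦ b + s` as unique optima, the rotation by `s` at slope
`θ = 2s` (there `θ ψ + α = s² − (r − s)²` on residues `r`, maximal exactly at `r = s`, and the only permutation all of whose
displacement residues equal `s` is the rotation).  So `Toeplitz.LinearInstanceBound m Φ → m ≤ Φ` — the first lower bound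
that grows with `m` in the kernel (the certified floors `18/23/26/28` at `m ≥ 6/7/8/9` are constants) — and the affine-wrap
rung `toeplitz_affineWrap_chain_succ_le` (`≤ m` members on residue-affine instances, p437290) is SHARP: this instance is
residue-affine.  Conjecture T (`O(m)`) is OPEN; nothing here bears on `TropicalB` for general designs, `KPlusLogSqLaw`,
`MatrixDescartes` or `VP ≠ VNP`.

THE RESULTS.
* `emod_eq_val_sub` — for `a b : Fin (n+1)`: `(a − b) mod (n+1) = ((a − b : Fin (n+1)) : ℕ)` (integer displacement vs cyclic
  difference; from `wrap_eq_residue_sub`).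
* `rotation_chain` — the explicit residue instance of size `n + 1` with the `n + 1` rotations as unique optima at the slopes
  `0, 2, 4, …, 2n` (every admissible set containing the rotations' displacements would do; stated with all permutations as
  competitors).
* `le_of_linearInstanceBound` — **`LinearInstanceBound m Φ → m ≤ Φ`** for every `m`; `not_linearInstanceBound_pred`.

References: folklore (cyclic assignment; the rotations are the vertices of the cyclic-profile simplex, cf. `…ToeplitzAffineWrap`).
-/

set_option linter.dupNamespace false
set_option autoImplicit false

namespace Summit.ValiantsHypothesis.ValiantsHypothesis.Theorems.KPlusLogSqLaw.Toeplitz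

open Summit.ValiantsHypothesis.ValiantsHypothesis.Theorems.KPlusLogSqLaw
open scoped BigOperators
open Finset

section Rotations

variable {n : ℕ}

/-- integer displacement versus cyclic difference: `(a − b) mod (n+1)` is the value of `a − b` in `Fin (n+1)`. [folklore] -/
theorem emod_eq_val_sub (a b : Fin (n + 1)) :
    ((a : ℤ) - b) % ((n + 1 : ℕ) : ℤ) = (((a - b : Fin (n + 1)) : ℕ) : ℤ) := by
  have hw := wrap_eq_residue_sub a b
  have hlt : (((a - b : Fin (n + 1)) : ℕ) : ℤ) < ((n + 1 : ℕ) : ℤ) := by exact_mod_cast (a - b).isLt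
  have h0 : (0 : ℤ) ≤ (((a - b : Fin (n + 1)) : ℕ) : ℤ) := by positivity
  have e : ((a : ℤ) - b) = (((a - b : Fin (n + 1)) : ℕ) : ℤ) + ((n + 1 : ℕ) : ℤ) * (-(if a < b then 1 else 0)) := by
    linarith
  rw [e, Int.add_mul_emod_self_left, Int.emod_eq_of_lt h0 hlt]

/-- **All rotations are unique optima of one residue instance.**  For `ψ(δ) = δ mod (n+1)`, `α(δ) = −(δ mod (n+1))²`, the
rotation `b ↦ b + s` is the UNIQUE maximiser (among all permutations of `Fin (n+1)`) at the slope `θ = 2s`; the slopes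
`0 < 2 < ⋯ < 2n` increase and the rotations are pairwise distinct: a chain of `n + 1` members. [folklore] -/
theorem rotation_chain (n : ℕ) :
    ∃ (ψ α : ℤ → ℤ) (θ' : Fin (n + 1) → ℤ) (τ : Fin (n + 1) → Equiv.Perm (Fin (n + 1))),
      StrictMono θ' ∧ Function.Injective τ ∧
      ∀ k (σ : Equiv.Perm (Fin (n + 1))), σ ≠ τ k →
        ∑ b, (θ' k * ψ ((σ b : ℤ) - b) + α ((σ b : ℤ) - b)) <
          ∑ b, (θ' k * ψ ((τ k b : ℤ) - b) + α ((τ k b : ℤ) - b)) := by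
  refine ⟨fun δ => δ % ((n + 1 : ℕ) : ℤ), fun δ => -(δ % ((n + 1 : ℕ) : ℤ)) ^ 2, fun k => 2 * (k : ℤ),
    fun k => Equiv.addRight k, fun k k' h => by simpa using h, fun k k' h => ?_, fun k σ hσ => ?_⟩
  · -- rotations are pairwise distinct
    have := congrArg (fun e : Equiv.Perm (Fin (n + 1)) => e 0) h
    simpa using this
  · -- unique optimality of the rotation by `k` at slope `2k`
    -- termwise: `2k·r − r² = k² − (r − k)² ≤ k²`, with equality iff the residue `r` equals `k`
    have hterm : ∀ σ' : Equiv.Perm (Fin (n + 1)), ∀ b : Fin (n + 1),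
        2 * (k : ℤ) * ((((σ' b : Fin (n + 1)) : ℤ) - b) % ((n + 1 : ℕ) : ℤ)) +
          -((((σ' b : Fin (n + 1)) : ℤ) - b) % ((n + 1 : ℕ) : ℤ)) ^ 2 =
          (k : ℤ) ^ 2 - ((((σ' b - b : Fin (n + 1)) : ℕ) : ℤ) - k) ^ 2 := by
      intro σ' b
      rw [emod_eq_val_sub]
      ring
    have hrot : ∀ b : Fin (n + 1),
        2 * (k : ℤ) * ((((Equiv.addRight k b : Fin (n + 1)) : ℤ) - b) % ((n + 1 : ℕ) : ℤ)) +
          -((((Equiv.addRight k b : Fin (n + 1)) : ℤ) - b) % ((n + 1 : ℕ) : ℤ)) ^ 2 = (k : ℤ) ^ 2 := by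
      intro b
      rw [hterm, addRight_sub_self]
      ring
    -- some column of `σ` has residue `≠ k`
    obtain ⟨b₀, hb₀⟩ : ∃ b, σ b - b ≠ k := by
      by_contra hall
      push Not at hall
      apply hσ
      ext b
      have := hall b
      rw [sub_eq_iff_eq_add] at this
      simp [this, add_comm]
    calc ∑ b, (2 * (k : ℤ) * ((((σ b : Fin (n + 1)) : ℤ) - b) % ((n + 1 : ℕ) : ℤ)) +
          -((((σ b : Fin (n + 1)) : ℤ) - b) % ((n + 1 : ℕ) : ℤ)) ^ 2)
        < ∑ _b : Fin (n + 1), (k : ℤ) ^ 2 := by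
          refine sum_lt_sum (fun b _ => ?_) ⟨b₀, mem_univ _, ?_⟩
          · rw [hterm]; nlinarith [sq_nonneg ((((σ b - b : Fin (n + 1)) : ℕ) : ℤ) - k)]
          · rw [hterm]
            have hne : (((σ b₀ - b₀ : Fin (n + 1)) : ℕ) : ℤ) - k ≠ 0 := by
              intro h
              apply hb₀
              apply Fin.ext
              exact_mod_cast (sub_eq_zero.mp h)
            have hpos : 0 < ((((σ b₀ - b₀ : Fin (n + 1)) : ℕ) : ℤ) - k) ^ 2 := by positivity
            linarith
      _ = ∑ b, (2 * (k : ℤ) * ((((Equiv.addRight k b : Fin (n + 1)) : ℤ) - b) % ((n + 1 : ℕ) : ℤ)) +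
          -((((Equiv.addRight k b : Fin (n + 1)) : ℤ) - b) % ((n + 1 : ℕ) : ℤ)) ^ 2) :=
          sum_congr rfl fun b _ => (hrot b).symm

/-- **`Φ_Toep(m) ≥ m` for every `m`**: a bound on the chains of all linear Toeplitz instances of size `m` is at least `m`
(the rotation chain; for `m = 0` the bound is `≥ 1 ≥ 0` by non-vacuity). [folklore] -/
theorem le_of_linearInstanceBound {m Φ : ℕ} (h : LinearInstanceBound m Φ) : m ≤ Φ := by
  rcases m with _ | n
  · exact Nat.zero_le _
  · obtain ⟨ψ, α, θ', τ, hθ, hτ, hu⟩ := rotation_chain n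
    exact h ψ α (fun _ => True) n θ' τ hθ hτ (fun _ _ => trivial) (fun k σ hσ _ => hu k σ hσ)

/-- `Φ_Toep(m) > m − 1` (for `m ≥ 1`). -/
theorem not_linearInstanceBound_pred {m : ℕ} (hm : 1 ≤ m) : ¬ LinearInstanceBound m (m - 1) := fun h => by
  have := le_of_linearInstanceBound h
  omega

end Rotations

end Summit.ValiantsHypothesis.ValiantsHypothesis.Theorems.KPlusLogSqLaw.Toeplitz
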